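import Summits.Ventures.PercRepro.Night2NonFatLevels
import Summits.Ventures.PercRepro.Night2BasisLevelOne

/-!
# night-2: the NON-FAT case of (FAIR) — the COLOOP targets of level 1 (gen 37)

For a lossy basis pair `(B, z)`, `Q = insert z B`, `W = G ∖ Q`, a point `y ∈ W` is a COLOOP POINT when `W ∖ {y}` has
rank `≤ 3` (then `W` has rank `4` and `y` is a coloop of `W`; on the nested-line geometries — `W` = the points of a long
basis line plus two points off it — both off-points are coloop points).  At the level-1 target `T = Q ∪ {y}`:

* `T` is unloaded (`|T ∖ K| = 6`, `dload_eq_zero_of_card_sdiff_le_six`) and `G ∖ T = W ∖ {y}` has rank `≤ 3`, so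
  `vCap T = 1` (`vCap_insert_eq_one_of_rkN_erase_le_three`);
* every thin four-point member `B' ⊆ T` leaves a remainder `R = T ∖ B'` of two points OFF the closure `P` of `W ∖ {y}`
  (`sdiff_disjoint_clF_of_thin_subset`: `rk (G ∖ B') ≥ 5` while `G ∖ B' ⊆ (W ∖ {y}) ∪ R`), and `B' ↦ R` is injective
  (`card_thin_faces_le_choose`), so the member faces inside `T` number at most `C(s, 2)`, `s = |(T ∖ K) ∖ P|`, and each
  weighs at most `(1/9) · 2` (`phiFace ≤ 1/9` with no fat closure, `|(T ∖ K) ∖ cl B'| ≤ |(T ∖ K) ∖ B'| = 2`):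
  **`faceSum_insert_le_choose`**: `faceSum T ≤ (2/9) · C(s, 2)`;
* hence the level-1 term of a coloop point is at least `9 / (2 C(s, 2))` (`level_one_term_ge_of_coloop`), and
  **`basis_pair_fair_of_coloop_sum`**: the fair share of the pair holds as soon as
  `1 ≤ Σ_{y coloop point} 9 / (2 C(s_y, 2))`; in particular **`basis_pair_fair_of_two_coloops`**: two coloop points whose
  planes `P` each contain two basis points (`s ≤ 4`, terms `≥ 3/4`) settle the pair.
Paper: proofs/NIGHT-2-g37.md §2.
-/

namespace PercRepro.Shadow

open PercRepro.ThmH PercRepro.PerFlat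

variable {α : Type*} [DecidableEq α] {M : Matroid α} [M.Finite] {G : Finset α}

/-! ## The capacity at a coloop target -/

/-- **A level-1 target of a basis pair is unloaded.** -/
theorem dload_insert_eq_zero (hG : G ∈ flatsQ M (5 + 1)) (hd : (gr M \ G).card = 2) (hk : kColoops M G = 1)
    (hs : ∀ e ∈ gr M, ∀ f ∈ gr M, e ≠ f → rkN M {e, f} = 2) (hl : ∀ e ∈ gr M, M.Indep {e})
    {B : Finset α} (hB : B ∈ thinMembers M 5 G) (hnP : ¬ bigP M G B) (z y : α) :
    dload M 5 G (bigP M G) (dshGT2 M 5 G) (insert y (insert z B)) = 0 := by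
  apply dload_eq_zero_of_card_sdiff_le_six hG hd hk hs hl
  have h4 := card_sdiff_eq_four_of_not_bigP hG hd hk hB hnP
  have h1 : insert y (insert z B) \ coloops M G ⊆ insert y (insert z (B \ coloops M G)) := by
    intro e he
    rw [Finset.mem_sdiff, Finset.mem_insert, Finset.mem_insert] at he
    rw [Finset.mem_insert, Finset.mem_insert, Finset.mem_sdiff]
    rcases he.1 with h | h | h
    · exact Or.inl h
    · exact Or.inr (Or.inl h)
    · exact Or.inr (Or.inr ⟨h, he.2⟩)
  calc (insert y (insert z B) \ coloops M G).card ≤ (insert y (insert z (B \ coloops M G))).card :=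
        Finset.card_le_card h1
    _ ≤ (insert z (B \ coloops M G)).card + 1 := Finset.card_insert_le _ _
    _ ≤ (B \ coloops M G).card + 1 + 1 := by
        have := Finset.card_insert_le z (B \ coloops M G)
        omega
    _ ≤ 6 := by omega

/-- **`vCap = 1` at the level-1 target of a coloop point**: `G ∖ (Q ∪ {y}) = W ∖ {y}` has rank `≤ 3`. -/
theorem vCap_insert_eq_one_of_rkN_erase_le_three (hG : G ∈ flatsQ M (5 + 1)) (hd : (gr M \ G).card = 2)
    (hk : kColoops M G = 1) (hs : ∀ e ∈ gr M, ∀ f ∈ gr M, e ≠ f → rkN M {e, f} = 2)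
    (hl : ∀ e ∈ gr M, M.Indep {e}) {B : Finset α} (hB : B ∈ thinMembers M 5 G) (hnP : ¬ bigP M G B) {z y : α}
    (hr : rkN M ((G \ insert z B).erase y) ≤ 3) :
    vCap M G (insert y (insert z B)) = 1 := by
  apply vCap_eq_one_of_rkN_sdiff_le_three hd (dload_insert_eq_zero hG hd hk hs hl hB hnP z y)
  rw [sdiff_insert_eq_erase]
  exact hr

/-! ## The member faces inside a coloop target -/

/-- At a level-1 target `T = insert y Q` of a basis pair, `|T ∖ K| = 6`. -/
theorem card_insert_sdiff_coloops_eq_six (hG : G ∈ flatsQ M (5 + 1)) (hd : (gr M \ G).card = 2)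
    (hk : kColoops M G = 1) {B : Finset α} (hB : B ∈ thinMembers M 5 G) (hnP : ¬ bigP M G B) {z : α}
    (hz : z ∈ G \ clF M B) {y : α} (hy : y ∈ G \ insert z B) :
    (insert y (insert z B) \ coloops M G).card = 6 := by
  have hd' : (gr M \ G).card ≤ 5 := by omega
  have h4 := card_sdiff_eq_four_of_not_bigP hG hd hk hB hnP
  have hKB : coloops M G ⊆ B := coloops_subset_of_mem_thinMembers hG hd' hB
  have hBG : B ⊆ G := subset_G_of_mem_thinMembers hB
  have hzB : z ∉ B := fun h => (Finset.mem_sdiff.1 hz).2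
    (subset_clF_of_subset_gr (hBG.trans (mem_flatsQ.1 hG).1) h)
  have hzK : z ∉ coloops M G := fun h => hzB (hKB h)
  have hyQ : y ∉ insert z B := (Finset.mem_sdiff.1 hy).2
  have hyK : y ∉ coloops M G := fun h => hyQ (Finset.mem_insert_of_mem (hKB h))
  have h1 : insert y (insert z B) \ coloops M G = insert y (insert z (B \ coloops M G)) := by
    ext e
    simp only [Finset.mem_sdiff, Finset.mem_insert]
    constructor
    · rintro ⟨h | h | h, hK⟩
      · exact Or.inl h
      · exact Or.inr (Or.inl h)
      · exact Or.inr (Or.inr ⟨h, hK⟩)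
    · rintro (rfl | rfl | ⟨h, hK⟩)
      · exact ⟨Or.inl rfl, hyK⟩
      · exact ⟨Or.inr (Or.inl rfl), hzK⟩
      · exact ⟨Or.inr (Or.inr h), hK⟩
  rw [h1, Finset.card_insert_of_notMem, Finset.card_insert_of_notMem, h4]
  · intro h
    exact hzB (Finset.mem_sdiff.1 h).1
  · intro h
    rw [Finset.mem_insert, Finset.mem_sdiff] at h
    rcases h with h | h
    · exact hyQ (h ▸ Finset.mem_insert_self _ _)
    · exact hyQ (Finset.mem_insert_of_mem h.1)

/-- **The remainder of a thin four-point member avoids the closure of `W ∖ {y}`** when that closure has rank `≤ 3`: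
`rk (G ∖ B') ≥ 5` and `G ∖ B' ⊆ (W ∖ {y}) ∪ (T ∖ B')` with `|T ∖ B'| = 2`. -/
theorem sdiff_disjoint_clF_of_thin_subset (hG : G ∈ flatsQ M (5 + 1)) (hd : (gr M \ G).card = 2)
    (hk : kColoops M G = 1) {B : Finset α} (hB : B ∈ thinMembers M 5 G) (hnP : ¬ bigP M G B) {z : α}
    (hz : z ∈ G \ clF M B) {y : α} (hy : y ∈ G \ insert z B)
    (hr : rkN M ((G \ insert z B).erase y) ≤ 3) {B' : Finset α} (hB' : B' ∈ thinMembers M 5 G)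
    (hnP' : ¬ bigP M G B') (hB'T : B' ⊆ insert y (insert z B)) :
    Disjoint (insert y (insert z B) \ B') (clF M ((G \ insert z B).erase y)) := by
  have hd' : (gr M \ G).card ≤ 5 := by omega
  set T := insert y (insert z B) with hT
  set W' := (G \ insert z B).erase y with hW'
  have hGg : G ⊆ gr M := (mem_flatsQ.1 hG).1
  have hKB' : coloops M G ⊆ B' := coloops_subset_of_mem_thinMembers hG hd' hB'
  have hTG : T ⊆ G := by
    rw [hT]
    exact Finset.insert_subset (Finset.mem_sdiff.1 hy).1
      (Finset.insert_subset (Finset.mem_sdiff.1 hz).1 (subset_G_of_mem_thinMembers hB))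
  -- `|T ∖ B'| = 2`
  have hR2 : (T \ B').card = 2 := by
    have h6 := card_insert_sdiff_coloops_eq_six hG hd hk hB hnP hz hy
    have h4 := card_sdiff_eq_four_of_not_bigP hG hd hk hB' hnP'
    have hsub : B' \ coloops M G ⊆ T \ coloops M G := Finset.sdiff_subset_sdiff hB'T (le_refl _)
    have heq : T \ B' = (T \ coloops M G) \ (B' \ coloops M G) := by
      ext e
      simp only [Finset.mem_sdiff, not_and, not_not]
      constructor
      · rintro ⟨heT, heB'⟩
        exact ⟨⟨heT, fun hK => heB' (hKB' hK)⟩, fun h => absurd h heB'⟩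
      · rintro ⟨⟨heT, heK⟩, h⟩
        exact ⟨heT, fun heB' => heK (h heB')⟩
    rw [heq, Finset.card_sdiff_of_subset hsub, h6, h4]
  -- `rk (G ∖ B') ≥ 5`
  have h5 : 5 ≤ rkN M (G \ B') := five_le_rkN_sdiff_of_mem_Uq hd (mem_membersIn.1 (mem_thinMembers.1 hB').1).1
  have hGT : G \ T = W' := by
    rw [hW', hT, sdiff_insert_eq_erase]
  rw [Finset.disjoint_left]
  intro r hr' hrcl
  -- `G ∖ B' ⊆ insert r (W' ∪ (T ∖ B').erase r)` with `r ∈ clF W'`: rank `≤ 3 + 1`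
  have hsub : G \ B' ⊆ insert r (W' ∪ (T \ B').erase r) := by
    intro e he
    have heG : e ∈ G := (Finset.mem_sdiff.1 he).1
    have heB' : e ∉ B' := (Finset.mem_sdiff.1 he).2
    by_cases her : e = r
    · exact Finset.mem_insert.2 (Or.inl her)
    · apply Finset.mem_insert_of_mem
      by_cases heT : e ∈ T
      · exact Finset.mem_union_right _ (Finset.mem_erase.2 ⟨her, Finset.mem_sdiff.2 ⟨heT, heB'⟩⟩)
      · apply Finset.mem_union_left
        rw [← hGT]
        exact Finset.mem_sdiff.2 ⟨heG, heT⟩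
  have hcl : r ∈ clF M (W' ∪ (T \ B').erase r) := clF_mono Finset.subset_union_left hrcl
  have hWg : W' ∪ (T \ B').erase r ⊆ gr M := by
    apply Finset.union_subset
    · rw [hW']
      exact (Finset.erase_subset _ _).trans (Finset.sdiff_subset.trans hGg)
    · exact (Finset.erase_subset _ _).trans (Finset.sdiff_subset.trans (hTG.trans hGg))
  have h1 := rkN_insert_le_of_mem_clF hWg hcl
  have h2 := rkN_union_le_add_card (M := M) W' ((T \ B').erase r)
  have h3 : ((T \ B').erase r).card = 1 := by
    rw [Finset.card_erase_of_mem hr', hR2]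
  have h4 := rkN_mono (M := M) hsub
  omega

open scoped Classical in
/-- **The member faces inside a coloop target inject into the two-point subsets of `(T ∖ K) ∖ P`**, `P` the closure of
`W ∖ {y}`: `B' ↦ T ∖ B'`. -/
theorem card_thin_faces_le_choose (hG : G ∈ flatsQ M (5 + 1)) (hd : (gr M \ G).card = 2)
    (hk : kColoops M G = 1) {B : Finset α} (hB : B ∈ thinMembers M 5 G) (hnP : ¬ bigP M G B) {z : α}
    (hz : z ∈ G \ clF M B) {y : α} (hy : y ∈ G \ insert z B)
    (hr : rkN M ((G \ insert z B).erase y) ≤ 3) :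
    ((thinMembers M 5 G).filter (fun B' => ¬ bigP M G B' ∧ B' ⊆ insert y (insert z B))).card ≤
      (((insert y (insert z B) \ coloops M G) \ clF M ((G \ insert z B).erase y)).card).choose 2 := by
  have hd' : (gr M \ G).card ≤ 5 := by omega
  set T := insert y (insert z B) with hT
  rw [← Finset.card_powersetCard]
  apply Finset.card_le_card_of_injOn (fun B' => T \ B')
  · intro B' hB'
    rw [Finset.mem_coe, Finset.mem_filter] at hB'
    obtain ⟨hB'thin, hnP', hB'T⟩ := hB'
    rw [Finset.mem_coe, Finset.mem_powersetCard]
    have hKB' : coloops M G ⊆ B' := coloops_subset_of_mem_thinMembers hG hd' hB'thin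
    have hdisj := sdiff_disjoint_clF_of_thin_subset hG hd hk hB hnP hz hy hr hB'thin hnP' hB'T
    refine ⟨?_, ?_⟩
    · intro e he
      rw [Finset.mem_sdiff, Finset.mem_sdiff]
      rw [Finset.mem_sdiff] at he
      refine ⟨⟨he.1, fun hK => he.2 (hKB' hK)⟩, ?_⟩
      exact Finset.disjoint_left.1 hdisj (Finset.mem_sdiff.2 he)
    · -- `|T ∖ B'| = 2`
      have h6 := card_insert_sdiff_coloops_eq_six hG hd hk hB hnP hz hy
      have h4 := card_sdiff_eq_four_of_not_bigP hG hd hk hB'thin hnP'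
      have hsub : B' \ coloops M G ⊆ T \ coloops M G := Finset.sdiff_subset_sdiff hB'T (le_refl _)
      have heq : T \ B' = (T \ coloops M G) \ (B' \ coloops M G) := by
        ext e
        simp only [Finset.mem_sdiff, not_and, not_not]
        constructor
        · rintro ⟨heT, heB'⟩
          exact ⟨⟨heT, fun hK => heB' (hKB' hK)⟩, fun h => absurd h heB'⟩
        · rintro ⟨⟨heT, heK⟩, h⟩
          exact ⟨heT, fun heB' => heK (h heB')⟩
      show (T \ B').card = 2
      rw [heq, Finset.card_sdiff_of_subset hsub, h6, h4]
  · intro B₁ hB₁ B₂ hB₂ heq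
    rw [Finset.mem_coe, Finset.mem_filter] at hB₁ hB₂
    simp only at heq
    have h1 : B₁ = T \ (T \ B₁) := (Finset.sdiff_sdiff_eq_self hB₁.2.2).symm
    have h2 : B₂ = T \ (T \ B₂) := (Finset.sdiff_sdiff_eq_self hB₂.2.2).symm
    rw [h1, h2, heq]

/-- **The face sum of a coloop target is at most `(2/9) · C(s, 2)`**, `s = |(T ∖ K) ∖ P|`. -/
theorem faceSum_insert_le_choose (hG : G ∈ flatsQ M (5 + 1)) (hd : (gr M \ G).card = 2)
    (hk : kColoops M G = 1) (hnf : fatClosures M 5 G 2 = ∅) {B : Finset α} (hB : B ∈ thinMembers M 5 G)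
    (hnP : ¬ bigP M G B) {z : α} (hz : z ∈ G \ clF M B) {y : α} (hy : y ∈ G \ insert z B)
    (hr : rkN M ((G \ insert z B).erase y) ≤ 3) :
    faceSum M G (insert y (insert z B)) ≤
      2 / 9 * (((((insert y (insert z B) \ coloops M G) \ clF M ((G \ insert z B).erase y)).card).choose 2 : ℕ) : ℚ) := by
  have hd' : (gr M \ G).card ≤ 5 := by omega
  set T := insert y (insert z B) with hT
  have hcount := card_thin_faces_le_choose hG hd hk hB hnP hz hy hr
  unfold faceSum
  calc ∑ B' ∈ (thinMembers M 5 G).filter (fun B' => ¬ bigP M G B' ∧ B' ⊆ T),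
        phiFace M B' * (((T \ coloops M G) \ clF M B').card : ℚ)
      ≤ ∑ B' ∈ (thinMembers M 5 G).filter (fun B' => ¬ bigP M G B' ∧ B' ⊆ T), (1 / 9 : ℚ) * 2 := by
        apply Finset.sum_le_sum
        intro B' hB'
        rw [Finset.mem_filter] at hB'
        obtain ⟨hB'thin, hnP', hB'T⟩ := hB'
        have hKB' : coloops M G ⊆ B' := coloops_subset_of_mem_thinMembers hG hd' hB'thin
        have hphi := phiFace_le_of_nonfat hG hd hnf hB'thin
        have hc : (((T \ coloops M G) \ clF M B').card : ℚ) ≤ 2 := by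
          have h6 := card_insert_sdiff_coloops_eq_six hG hd hk hB hnP hz hy
          have h4 := card_sdiff_eq_four_of_not_bigP hG hd hk hB'thin hnP'
          have hsub : B' \ coloops M G ⊆ T \ coloops M G := Finset.sdiff_subset_sdiff hB'T (le_refl _)
          have hsub2 : (T \ coloops M G) \ clF M B' ⊆ (T \ coloops M G) \ (B' \ coloops M G) := by
            intro e he
            rw [Finset.mem_sdiff] at he ⊢
            refine ⟨he.1, fun h => he.2 ?_⟩
            exact subset_clF_of_subset_gr ((subset_G_of_mem_thinMembers hB'thin).trans (mem_flatsQ.1 hG).1)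
              (Finset.mem_sdiff.1 h).1
          have := Finset.card_le_card hsub2
          rw [Finset.card_sdiff_of_subset hsub, h6, h4] at this
          exact_mod_cast this
        exact mul_le_mul hphi hc (by positivity) (by norm_num)
    _ = (1 / 9 : ℚ) * 2 * (((thinMembers M 5 G).filter (fun B' => ¬ bigP M G B' ∧ B' ⊆ T)).card : ℚ) := by
        rw [Finset.sum_const, nsmul_eq_mul, mul_comm]
    _ ≤ (1 / 9 : ℚ) * 2 * ((((T \ coloops M G) \ clF M ((G \ insert z B).erase y)).card.choose 2 : ℕ) : ℚ) := by
        apply mul_le_mul_of_nonneg_left _ (by norm_num)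
        exact_mod_cast hcount
    _ = 2 / 9 * ((((T \ coloops M G) \ clF M ((G \ insert z B).erase y)).card.choose 2 : ℕ) : ℚ) := by ring

/-! ## The level-1 term of a coloop point -/

/-- **The level-1 term of a coloop point is at least `9 / (2 C(s, 2))`.** -/
theorem level_one_term_ge_of_coloop (hG : G ∈ flatsQ M (5 + 1)) (hd : (gr M \ G).card = 2)
    (hk : kColoops M G = 1) (hs : ∀ e ∈ gr M, ∀ f ∈ gr M, e ≠ f → rkN M {e, f} = 2)
    (hl : ∀ e ∈ gr M, M.Indep {e}) (hnf : fatClosures M 5 G 2 = ∅) {B : Finset α}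
    (hB : B ∈ thinMembers M 5 G) (hnP : ¬ bigP M G B) {z : α} (hz : z ∈ G \ clF M B)
    (hl0 : loss M 5 G B z ≠ 0) {y : α} (hy : y ∈ G \ insert z B)
    (hr : rkN M ((G \ insert z B).erase y) ≤ 3) :
    9 / (2 * (((((insert y (insert z B) \ coloops M G) \ clF M ((G \ insert z B).erase y)).card).choose 2 : ℕ) : ℚ)) ≤
      vCap M G (insert y (insert z B)) / faceSum M G (insert y (insert z B)) := by
  have hT : insert y (insert z B) ∈ tgtSets M 5 G B z :=
    level_one_targets_subset hG hB hz (Finset.mem_image.2 ⟨y, hy, rfl⟩)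
  have hpos := faceSum_pos_of_mem_tgtSets hG hd hk hB hnP hz hl0 hT
  have hle := faceSum_insert_le_choose hG hd hk hnf hB hnP hz hy hr
  rw [vCap_insert_eq_one_of_rkN_erase_le_three hG hd hk hs hl hB hnP hr]
  set c : ℚ := ((((insert y (insert z B) \ coloops M G) \ clF M ((G \ insert z B).erase y)).card.choose 2 : ℕ) : ℚ)
    with hc
  have hcpos : 0 < 2 / 9 * c := lt_of_lt_of_le hpos hle
  rw [div_le_div_iff₀ (by linarith) hpos]
  linarith

open scoped Classical in
/-- **The fair share from the coloop points alone**: with `s_y = |(Q ∪ {y} ∖ K) ∖ cl (W ∖ {y})|`,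
`1 ≤ Σ_{y ∈ W, rk (W ∖ {y}) ≤ 3} 9 / (2 C(s_y, 2))` gives the fair share of the lossy basis pair `(B, z)`. -/
theorem basis_pair_fair_of_coloop_sum (hG : G ∈ flatsQ M (5 + 1)) (hd : (gr M \ G).card = 2)
    (hk : kColoops M G = 1) (hs : ∀ e ∈ gr M, ∀ f ∈ gr M, e ≠ f → rkN M {e, f} = 2)
    (hl : ∀ e ∈ gr M, M.Indep {e}) (hnf : fatClosures M 5 G 2 = ∅) {B : Finset α}
    (hB : B ∈ thinMembers M 5 G) (hnP : ¬ bigP M G B) {z : α} (hz : z ∈ G \ clF M B)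
    (hl0 : loss M 5 G B z ≠ 0)
    (hsum : 1 ≤ ∑ y ∈ (G \ insert z B).filter (fun y => rkN M ((G \ insert z B).erase y) ≤ 3),
      9 / (2 * (((((insert y (insert z B) \ coloops M G) \ clF M ((G \ insert z B).erase y)).card).choose 2 : ℕ) : ℚ))) :
    loss M 5 G B z ≤ rhoL M 5 G B z * lossIncomeH M 5 G (bigP M G) (dshGT2 M 5 G) B z := by
  have hfat : (fatClosures M 5 G 2).card ≤ 1 := by
    rw [hnf, Finset.card_empty]
    exact zero_le_one
  apply basis_pair_fair_of_level_one_sum hG hd hk hs hl hfat hB hnP hz hl0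
  calc (1 : ℚ) ≤ ∑ y ∈ (G \ insert z B).filter (fun y => rkN M ((G \ insert z B).erase y) ≤ 3),
        9 / (2 * (((((insert y (insert z B) \ coloops M G) \ clF M ((G \ insert z B).erase y)).card).choose 2 : ℕ) : ℚ)) :=
        hsum
    _ ≤ ∑ y ∈ (G \ insert z B).filter (fun y => rkN M ((G \ insert z B).erase y) ≤ 3),
        vCap M G (insert y (insert z B)) / faceSum M G (insert y (insert z B)) := by
        apply Finset.sum_le_sum
        intro y hy
        rw [Finset.mem_filter] at hy
        exact level_one_term_ge_of_coloop hG hd hk hs hl hnf hB hnP hz hl0 hy.1 hy.2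
    _ ≤ ∑ y ∈ G \ insert z B, vCap M G (insert y (insert z B)) / faceSum M G (insert y (insert z B)) := by
        apply Finset.sum_le_sum_of_subset_of_nonneg (Finset.filter_subset _ _)
        intro y hy _
        apply div_nonneg (vCap_nonneg _)
        exact (faceSum_pos_of_mem_tgtSets hG hd hk hB hnP hz hl0
          (level_one_targets_subset hG hB hz (Finset.mem_image.2 ⟨y, hy, rfl⟩))).le

/-- **Two coloop points whose planes each contain two basis points settle the pair**: `s ≤ 4` gives terms `≥ 3/4`. -/
theorem basis_pair_fair_of_two_coloops (hG : G ∈ flatsQ M (5 + 1)) (hd : (gr M \ G).card = 2)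
    (hk : kColoops M G = 1) (hs : ∀ e ∈ gr M, ∀ f ∈ gr M, e ≠ f → rkN M {e, f} = 2)
    (hl : ∀ e ∈ gr M, M.Indep {e}) (hnf : fatClosures M 5 G 2 = ∅) {B : Finset α}
    (hB : B ∈ thinMembers M 5 G) (hnP : ¬ bigP M G B) {z : α} (hz : z ∈ G \ clF M B)
    (hl0 : loss M 5 G B z ≠ 0) {y₁ y₂ : α} (hne : y₁ ≠ y₂) (hy₁ : y₁ ∈ G \ insert z B)
    (hy₂ : y₂ ∈ G \ insert z B) (hr₁ : rkN M ((G \ insert z B).erase y₁) ≤ 3)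
    (hr₂ : rkN M ((G \ insert z B).erase y₂) ≤ 3)
    (hs₁ : ((insert y₁ (insert z B) \ coloops M G) \ clF M ((G \ insert z B).erase y₁)).card ≤ 4)
    (hs₂ : ((insert y₂ (insert z B) \ coloops M G) \ clF M ((G \ insert z B).erase y₂)).card ≤ 4) :
    loss M 5 G B z ≤ rhoL M 5 G B z * lossIncomeH M 5 G (bigP M G) (dshGT2 M 5 G) B z := by
  have hfat : (fatClosures M 5 G 2).card ≤ 1 := by
    rw [hnf, Finset.card_empty]
    exact zero_le_one
  apply basis_pair_fair_of_level_one_sum hG hd hk hs hl hfat hB hnP hz hl0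
  have hterm : ∀ y ∈ G \ insert z B, rkN M ((G \ insert z B).erase y) ≤ 3 →
      ((insert y (insert z B) \ coloops M G) \ clF M ((G \ insert z B).erase y)).card ≤ 4 →
      (3 / 4 : ℚ) ≤ vCap M G (insert y (insert z B)) / faceSum M G (insert y (insert z B)) := by
    intro y hy hr hs4
    refine le_trans ?_ (level_one_term_ge_of_coloop hG hd hk hs hl hnf hB hnP hz hl0 hy hr)
    have hch : (((insert y (insert z B) \ coloops M G) \ clF M ((G \ insert z B).erase y)).card).choose 2 ≤ 6 := by
      calc (((insert y (insert z B) \ coloops M G) \ clF M ((G \ insert z B).erase y)).card).choose 2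
          ≤ Nat.choose 4 2 := Nat.choose_le_choose 2 hs4
        _ = 6 := by decide
    have hch' : ((((insert y (insert z B) \ coloops M G) \ clF M ((G \ insert z B).erase y)).card.choose 2 : ℕ) : ℚ)
        ≤ 6 := by exact_mod_cast hch
    have hpos := faceSum_pos_of_mem_tgtSets hG hd hk hB hnP hz hl0
      (level_one_targets_subset hG hB hz (Finset.mem_image.2 ⟨y, hy, rfl⟩))
    have hle := faceSum_insert_le_choose hG hd hk hnf hB hnP hz hy hr
    have hcpos : (0 : ℚ) <
        ((((insert y (insert z B) \ coloops M G) \ clF M ((G \ insert z B).erase y)).card.choose 2 : ℕ) : ℚ) := by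
      by_contra h
      rw [not_lt] at h
      linarith
    rw [div_le_div_iff₀ (by norm_num) (by linarith)]
    linarith
  have h1 := hterm y₁ hy₁ hr₁ hs₁
  have h2 := hterm y₂ hy₂ hr₂ hs₂
  have hnn : ∀ y ∈ G \ insert z B, 0 ≤ vCap M G (insert y (insert z B)) / faceSum M G (insert y (insert z B)) := by
    intro y hy
    apply div_nonneg (vCap_nonneg _)
    exact (faceSum_pos_of_mem_tgtSets hG hd hk hB hnP hz hl0
      (level_one_targets_subset hG hB hz (Finset.mem_image.2 ⟨y, hy, rfl⟩))).le
  have hsub : {y₁, y₂} ⊆ G \ insert z B := by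
    intro e he
    rw [Finset.mem_insert, Finset.mem_singleton] at he
    rcases he with rfl | rfl
    · exact hy₁
    · exact hy₂
  calc (1 : ℚ) ≤ 3 / 4 + 3 / 4 := by norm_num
    _ ≤ ∑ y ∈ ({y₁, y₂} : Finset α), vCap M G (insert y (insert z B)) / faceSum M G (insert y (insert z B)) := by
        rw [Finset.sum_pair hne]
        linarith
    _ ≤ ∑ y ∈ G \ insert z B, vCap M G (insert y (insert z B)) / faceSum M G (insert y (insert z B)) :=
        Finset.sum_le_sum_of_subset_of_nonneg hsub (fun y hy _ => hnn y hy)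

end PercRepro.Shadow
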